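import Literature.NumberTheory.Automorphic.PairLFunctionNeConjGlobalRankinSelberg

/-!
# The global Rankin–Selberg theorem for a pair of cusp forms with a GENERAL test function

Summit `Langlands`, sub-problem `Langlands`, helper file under `Theorems/` supporting the crux
`PairLBoundaryJS` (stmt-Langlands-13622, Arthur–Clozel (1989), Ch. 3, (2.2)), line `Sketch`
(skeleton v8, registered stub `stub_global_pair_gen`).

`stub_global_pair_gen` (**main**, §2) is the tree theorem
`Literature.NumberTheory.Automorphic.exists_entire_eq_mul_partialPairL_mul_setIntegral_pair`
(`PairLFunctionNeConjGlobalRankinSelberg`; Cogdell (2004), §2.3 Thm. 2.1–2.2 and §4.2; Jacquet–Shalika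
(1981), §4) with ONE change: the frozen standard test function `Φ = Φ_∞ ⊗ 𝟙_{𝒪̂ⁿ}`
(`standardTestFun n K Φ_∞`) is replaced by an arbitrary real test function `Φ : 𝔸_Kⁿ → ℝ` that is
continuous, `≥ 0`, Schwartz–Bruhat (`(Φ : ℂ) ∈ piSchwartzBruhat K (Fin n)`) and SPHERICAL OFF `S'`
only — invariant under the integral scalings at `v` on the `v`-integral vectors
(`IsLastRowSphericalAt n K Φ v`) and supported in the `v`-integral vectors, at every `v ∉ S'`. This is
the shape `Φ = Φ_∞ ⊗ Φ_{S'} ⊗ 𝟙^{S'}` of the printed method (Jacquet–Shalika (1981), (5.1): "`Φ`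
unramified outside `S`"; Cogdell (2004), §2.3 and §4.1), under which the local Rankin–Selberg data at
the bad places `S'` may use arbitrary Schwartz–Bruhat `Φ_v`. The residue clause `F(1) = 0` for
`π ≠ π'` of the tree theorem is dropped (the line does not consume it). Statement: there is `C > 0`
(Haar measures) such that for all cuspidal `π`, `π'` of `GL_n(𝔸_K)` (`0 < n`) with Satake families
`α`, `γ` off `S`, all `f ∈ π`, `f' ∈ π'` with the same unitary central scalars, every test function
`η` of level `K(𝔫₀)`, every `S' ⊇ S` off which `v ∤ 𝔫₀ 𝔡_K`, all enumerations `x`, `y` of `α`, `γ`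
off `S'` and every such `Φ`, there is an ENTIRE `F` with `F(s) = s (s - 1) I(s; S̄_η f', S_η f, Φ)`
for `re s > 1` and `F(s) = s (s - 1) · C · partialPairL S' α γ̄ s · ∫_{B({v ∉ S'}) × K} I_s` for
`1 < re s < 2`.

Proof: verbatim the tree's. Three of its four inputs are already stated for a general real
Schwartz–Bruhat `Φ ≥ 0` — the unfolding identity on the strip
(`exists_rankinSelbergIntegral_star_eq_mul_rankinSelbergTorusPairIntegralC`), the entire continuation
of `s (s - 1) I(s)` (`exists_entire_eq_mul_rankinSelbergIntegral_star_of_ne`) and the finiteness of the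
real unfolded integrals (`rankinSelbergTorusIntegral_whittakerCoeff_ne_top_of_mem_piSchwartzBruhat`);
the fourth, the Euler factorisation `rankinSelbergTorusPairIntegralC_whittakerCoeff_eq_partialPairL_mul`
(`RankinSelbergUnfoldedEulerCuspidalPairs`, frozen `Φ`), is re-proved in §1 for a general `Φ`
spherical off `S'` (`rankinSelbergTorusPairIntegralC_whittakerCoeff_eq_partialPairL_mul_of_spherical`)
by the tree's own proof, the abstract factorisation
`rankinSelbergTorusPairIntegralC_eq_mul_setIntegral_of_hasProd` (`RankinSelbergTorusPairEuler`) being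
stated for such a `Φ`.

## References

* J. W. Cogdell, *Analytic theory of L-functions for GL_n*, in *An Introduction to the Langlands
  Program* (2004), §2.3 Thm. 2.1–2.2, §3 Thm. 3.3, §4.2 [CogdellAnalyticTheory2004].
* H. Jacquet, J. A. Shalika, *On Euler products and the classification of automorphic
  representations I, II*, Amer. J. Math. 103 (1981), I §2 Prop. (2.3), §4, (5.1), Thm. (5.3)
  [JacquetShalikaAJM1981].
* C. Mœglin, J.-L. Waldspurger, *Le spectre résiduel de GL(n)*, Ann. Sci. ÉNS 22 (1989), Appendice,
  Corollaire (i)(b), p. 667 [MoeglinWaldspurger1989].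
-/

noncomputable section

-- `Summit.Langlands.Langlands.…` (summit = sub-problem name, D-0017 layout) trips `dupNamespace`
set_option linter.dupNamespace false

open scoped MatrixGroups Topology Pointwise ENNReal NNReal ComplexConjugate InnerProductSpace
open NumberField IsDedekindDomain MeasureTheory Measure Matrix Set Filter
open Literature.NumberTheory.Automorphic AdelicGroupData
open Literature.NumberTheory.GaloisRepresentations (ideleGroup localUnits)
open Literature.RingTheory.SymmetricFunctions.SymmPoly

-- the automorphic quotient carries the tree's Borel σ-algebra, not Mathlib's quotient σ-algebra
attribute [-instance] Quotient.instMeasurableSpace QuotientGroup.measurableSpace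

-- the house local instances, exactly as in `RankinSelbergUnfoldingIdentity`
attribute [local instance] adelicBorel borelSpace_adelic locallyCompactSpace_adelic secondCountableTopology_gl_adelic
  glAdeleBorel borelSpace_glAdele borelSpace_ideleGroup secondCountableTopology_ideleGroup

namespace Summit.Langlands.Langlands.Theorems.GlobalPairGen

open ValuativeRel

/-! ### §1 The Euler factorisation of the unfolded pair integral for a general `Φ` spherical off `S'` -/

section Cuspidal

open ValuativeRel

variable {n : ℕ} {K : Type} [Field K] [NumberField K]
  {μ : Measure (AdelicGroupData.gl n K).automorphicQuotient} [(AdelicGroupData.gl n K).IsAutomorphicMeasure μ]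
variable [MeasurableSpace ↥(adelicUnipotent n K)] [BorelSpace ↥(adelicUnipotent n K)]
  [MeasurableConstSMul ↥(rationalUnipotent n K) ↥(adelicUnipotent n K)]
  {ν : Measure ↥(adelicUnipotent n K)} [IsFiniteMeasureOnCompacts ν]
  [SMulInvariantMeasure ↥(rationalUnipotent n K) ↥(adelicUnipotent n K) ν] [ν.IsMulRightInvariant]
  {𝓕 : Set ↥(adelicUnipotent n K)} {ψ : AddChar (AdeleRing (𝓞 K) K) Circle}
variable [MeasurableSpace (ideleGroup K)] [BorelSpace (ideleGroup K)]

-- the house local instances of `RankinSelbergUnfoldedEulerCuspidalPairs`; none overrides a Mathlib instance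
attribute [local instance] adelicBorel borelSpace_adelic locallyCompactSpace_adelic
  secondCountableTopology_gl_adelic secondCountableTopology_ideleGroup glAdeleBorel borelSpace_glAdele

/-- **`Ψ(s; W_φ, W̄_{φ'}, Φ) = L^{S'}(s, α ⊗ γ̄) · Ψ_{S'}(s)` on `re s > 1` for a general test function
`Φ ≥ 0` spherical off `S'`.** Let `π`, `π'` be cuspidal automorphic representations of `GL_n(𝔸_K)`
(`0 < n`) with Satake families `α`, `γ` off `S`, `f ∈ π`, `f' ∈ π'`, `η` a continuous compactly
supported left `K(𝔫₀)`-invariant weight, `W`, `W'` the global Whittaker coefficients of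
`invQuot (S_η f)`, `invQuot (S_η f')`, and `S' ⊇ S` a set of finite places off which `v ∤ 𝔫₀` and
`ψ_v` has conductor `𝒪_v`. Let `Φ : 𝔸_Kⁿ → ℝ`, `Φ ≥ 0`, with `g ↦ Φ(e_n g)` measurable, be spherical at
every `v ∉ S'`: invariant under the integral scalings at `v` on the `v`-integral vectors
(`IsLastRowSphericalAt`) and supported in the `v`-integral vectors. For `re s > 1`, if the two real
unfolded integrals `Ψ(re s; W, W̄, Φ)`, `Ψ(re s; W', W̄', Φ)` are finite, then
`Ψ(s; W, W̄', Φ) = partialPairL S' α γ̄ s · ∫_{B({v ∉ S'}) × K} W W̄' Φ(e_n ·) |det|^s δ_B⁻¹`.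
The tree's `rankinSelbergTorusPairIntegralC_whittakerCoeff_eq_partialPairL_mul` is the case
`Φ = Φ_∞ ⊗ 𝟙_{𝒪̂ⁿ}`; the proof is the same (Cogdell (2004), Thm. 2.2 with Thm. 3.3; Jacquet–Shalika
(1981), §4, (5.1) and Thm. (5.3), proof). -/
theorem rankinSelbergTorusPairIntegralC_whittakerCoeff_eq_partialPairL_mul_of_spherical (hn : 0 < n)
    (P Q : CuspidalAutomorphicRepGL n K μ) {S : Set (HeightOneSpectrum (𝓞 K))} {α γ : SatakeFamily K}
    (hα : IsSatakeFamilyOf P S α) (hγ : IsSatakeFamilyOf Q S γ) {𝔫₀ : Ideal (𝓞 K)} (h𝔫₀ : 𝔫₀ ≠ 0)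
    {η : (AdelicGroupData.gl n K).Adelic → ℝ} (hη : Continuous η) (hηs : HasCompactSupport η)
    (hηK : ∀ k : (AdelicGroupData.gl n K).Adelic, k ∈ principalCongruenceLevel n K 𝔫₀ →
      ∀ g : (AdelicGroupData.gl n K).Adelic, η (k * g) = η g)
    (f : P.1.toSubmodule) (f' : Q.1.toSubmodule)
    (h𝓕 : IsFundamentalDomain ↥(rationalUnipotent n K) 𝓕 ν) (h𝓕m : MeasurableSet 𝓕)
    (h𝓕c : IsCompact (closure 𝓕)) (hψ : IsGlobalAddChar K ψ)
    {S' : Set (HeightOneSpectrum (𝓞 K))} (hSS' : S ⊆ S')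
    (hGood : ∀ v ∉ S', ¬ v.asIdeal ∣ 𝔫₀ ∧ (∀ c ∈ 𝒪[v.adicCompletion K], ψ.adicComponent v c = 1) ∧
      ∀ ϖ : v.adicCompletion K, Valued.v ϖ = WithZero.exp (-1 : ℤ) →
        ∃ c ∈ 𝒪[v.adicCompletion K], ψ.adicComponent v (ϖ⁻¹ * c) ≠ 1)
    {x y : HeightOneSpectrum (𝓞 K) → Fin n → ℂ}
    (hx : ∀ v ∉ S', (Finset.univ : Finset (Fin n)).val.map (x v) = α v)
    (hy : ∀ v ∉ S', (Finset.univ : Finset (Fin n)).val.map (y v) = γ v)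
    {Φ : (Fin n → AdeleRing (𝓞 K) K) → ℝ} (hΦ0 : ∀ y, 0 ≤ Φ y)
    (hΦsph : ∀ v ∉ S', IsLastRowSphericalAt n K Φ v)
    (hΦv : ∀ v ∉ S', ∀ y : Fin n → AdeleRing (𝓞 K) K, Φ y ≠ 0 → ∀ j, Valued.v ((y j).2 v) ≤ 1)
    (hΦm : Measurable fun g : GL (Fin n) (AdeleRing (𝓞 K) K) => Φ (lastRow n K g))
    (νA : Measure (Fin n → ideleGroup K)) [νA.IsMulLeftInvariant] [SFinite νA]
    (νK : Measure ↥(maximalCompactAdelic n K)) [SFinite νK] {s : ℂ} (hs : 1 < s.re)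
    (hfin : rankinSelbergTorusIntegral n K νA νK
      (whittakerCoeff ν 𝓕 ψ
        (invQuot (AdelicGroupData.gl n K) (smoothedForm η (f : (AdelicGroupData.gl n K).L2 μ))))
      Φ s.re ≠ ⊤)
    (hfin' : rankinSelbergTorusIntegral n K νA νK
      (whittakerCoeff ν 𝓕 ψ
        (invQuot (AdelicGroupData.gl n K) (smoothedForm η (f' : (AdelicGroupData.gl n K).L2 μ))))
      Φ s.re ≠ ⊤) :
    rankinSelbergTorusPairIntegralC n K νA νK
        (whittakerCoeff ν 𝓕 ψ
          (invQuot (AdelicGroupData.gl n K) (smoothedForm η (f : (AdelicGroupData.gl n K).L2 μ))))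
        (star (whittakerCoeff ν 𝓕 ψ
          (invQuot (AdelicGroupData.gl n K) (smoothedForm η (f' : (AdelicGroupData.gl n K).L2 μ)))))
        Φ s =
      partialPairL S' α (fun v => (γ v).map conj) s *
        ∫ p in unitBox {v | v ∉ S'} ×ˢ Set.univ, torusPairIntegrandC n K
          (whittakerCoeff ν 𝓕 ψ
            (invQuot (AdelicGroupData.gl n K) (smoothedForm η (f : (AdelicGroupData.gl n K).L2 μ))))
          (star (whittakerCoeff ν 𝓕 ψ
            (invQuot (AdelicGroupData.gl n K) (smoothedForm η (f' : (AdelicGroupData.gl n K).L2 μ)))))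
          Φ s p ∂(νA.prod νK) := by
  classical
  set φ : GL (Fin n) (AdeleRing (𝓞 K) K) → ℂ :=
    invQuot (AdelicGroupData.gl n K) (smoothedForm η (f : (AdelicGroupData.gl n K).L2 μ)) with hφ
  set φ' : GL (Fin n) (AdeleRing (𝓞 K) K) → ℂ :=
    invQuot (AdelicGroupData.gl n K) (smoothedForm η (f' : (AdelicGroupData.gl n K).L2 μ)) with hφ'
  set W : GL (Fin n) (AdeleRing (𝓞 K) K) → ℂ := whittakerCoeff ν 𝓕 ψ φ with hWdef
  set W' : GL (Fin n) (AdeleRing (𝓞 K) K) → ℂ := whittakerCoeff ν 𝓕 ψ φ' with hW'def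
  have hGood' : ∀ v ∈ {v : HeightOneSpectrum (𝓞 K) | v ∉ S'}, v ∉ S ∧ ¬ v.asIdeal ∣ 𝔫₀ ∧
      (∀ c ∈ 𝒪[v.adicCompletion K], ψ.adicComponent v c = 1) ∧
      ∀ ϖ : v.adicCompletion K, Valued.v ϖ = WithZero.exp (-1 : ℤ) →
        ∃ c ∈ 𝒪[v.adicCompletion K], ψ.adicComponent v (ϖ⁻¹ * c) ≠ 1 :=
    fun v hv => ⟨fun h => hv (hSS' h), hGood v hv⟩
  -- the uniformizers of the Satake data of `π` at the good places, shared with `π'`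
  have hex : ∀ v ∉ S', ∃ ϖ : (v.adicCompletion K)ˣ, IsTorusUnramifiedAt n K W v ϖ (x v) := fun v hv =>
    exists_isTorusUnramifiedAt_whittakerCoeff_smoothedForm P hα h𝔫₀ (hGood' v hv).1 (hGood v hv).1
      hη hηs hηK f (hx v hv) h𝓕 h𝓕c hψ (hGood v hv).2.1 (hGood v hv).2.2
  have hex' : ∀ v ∉ S', ∃ ϖ : (v.adicCompletion K)ˣ, IsTorusUnramifiedAt n K W' v ϖ (y v) := fun v hv =>
    exists_isTorusUnramifiedAt_whittakerCoeff_smoothedForm Q hγ h𝔫₀ (hGood' v hv).1 (hGood v hv).1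
      hη hηs hηK f' (hy v hv) h𝓕 h𝓕c hψ (hGood v hv).2.1 (hGood v hv).2.2
  let ϖ : ∀ v : HeightOneSpectrum (𝓞 K), (v.adicCompletion K)ˣ := fun v =>
    if hv : v ∉ S' then Classical.choose (hex v hv) else 1
  have hW : ∀ v ∉ S', IsTorusUnramifiedAt n K W v (ϖ v) (x v) := fun v hv => by
    simp only [ϖ, dif_pos hv]
    exact Classical.choose_spec (hex v hv)
  have hW' : ∀ v ∉ S', IsTorusUnramifiedAt n K (star W') v (ϖ v) (star (y v)) := fun v hv => by
    obtain ⟨ϖ', hϖ'⟩ := hex' v hv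
    exact (hϖ'.of_valued_eq (hW v hv).valued_eq).star
  -- central invariance of `‖W‖`
  obtain ⟨ω, hu, -, -, -, -, hcl⟩ := P.exists_centralCharacter_smoothedForm
  have hWZ : ∀ (z : ideleGroup K) (g : GL (Fin n) (AdeleRing (𝓞 K) K)),
      ‖W (Matrix.GeneralLinearGroup.scalar (Fin n) z * g)‖ = ‖W g‖ := fun z g => by
    rw [hWdef, whittakerCoeff_scalar_mul (fun g' => hcl η f z g') g, norm_mul, hu z, one_mul]
  -- integrability of the complex pair integrand
  have hWc : Continuous W := continuous_whittakerCoeff h𝓕m h𝓕c hψ.continuous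
    (continuous_invQuot_smoothedForm hη hηs _)
  have hW'c : Continuous W' := continuous_whittakerCoeff h𝓕m h𝓕c hψ.continuous
    (continuous_invQuot_smoothedForm hη hηs _)
  have hW'sc : Continuous (star W') := hW'c.star
  haveI : SecondCountableTopology (GL (Fin n) (AdeleRing (𝓞 K) K)) :=
    secondCountableTopology_generalLinearGroup_adeleRing K (Fin n)
  haveI : SecondCountableTopology (AdelicGroupData.gl n K).Adelic :=
    secondCountableTopology_generalLinearGroup_adeleRing K (Fin n)
  haveI : SecondCountableTopology ↥(maximalCompactAdelic n K) := TopologicalSpace.Subtype.secondCountableTopology _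
  have hpt : Measurable (torusPoint n K) := continuous_torusPoint.measurable
  have hmeas : Measurable (torusPairIntegrandC n K W (star W') Φ s) :=
    measurable_torusPairIntegrandC (hWc.measurable.comp hpt) (hW'sc.measurable.comp hpt) (hΦm.comp hpt) s
  have hfin'' : rankinSelbergTorusIntegral n K νA νK (star W') Φ s.re ≠ ⊤ := by
    rw [rankinSelbergTorusIntegral_star]; exact hfin'
  have hint : Integrable (torusPairIntegrandC n K W (star W') Φ s) (νA.prod νK) :=
    integrable_torusPairIntegrandC νA νK hΦ0 hmeas.aestronglyMeasurable (measurable_torusIntegrand hWc hΦm s.re)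
      (measurable_torusIntegrand hW'sc hΦm s.re) hfin hfin''
  -- finiteness of the real torus sums at `re s` from the Satake bound
  have hy' : ∀ v ∉ S', (Finset.univ : Finset (Fin n)).val.map (star (y v)) = (γ v).map conj := fun v hv => by
    rw [← hy v hv, Multiset.map_map]
    rfl
  have hTx : ∀ v ∉ S', schurSelfSum (x v) ((v.residueCard : ℝ) ^ (-s.re)) ≠ ⊤ := fun v hv =>
    schurSelfSum_ne_top_of_norm_satakeParameter_le_sqrt norm_satakeParameter_le_sqrt_holds P hα
      (hGood' v hv).1 (x v) (hx v hv) hs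
  have hTy : ∀ v ∉ S', schurSelfSum (star (y v)) ((v.residueCard : ℝ) ^ (-s.re)) ≠ ⊤ := fun v hv =>
    schurSelfSum_ne_top_of_norm_satakeParameter_le_sqrt norm_satakeParameter_le_sqrt_holds Q.conj hγ.conj
      (hGood' v hv).1 (star (y v)) (hy' v hv) hs
  -- the Euler product of the local factors
  have hL := hasProd_partialPairL JacquetShalika1981_multipliable_partialPairL_holds P Q.conj (hα.mono hSS')
    (hγ.mono hSS').conj hs
  exact rankinSelbergTorusPairIntegralC_eq_mul_setIntegral_of_hasProd νA νK hn hW hW' hWZ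
    hΦsph hΦv hΦ0 hint hTx hTy hx hy' hL

end Cuspidal

/-! ### §2 The global half of Corollaire (i)(b) for a general test function -/

/-- **The global Rankin–Selberg theorem for a pair, general test function.** There is a constant
`C > 0`, depending only on the Haar measures, such that for all cuspidal automorphic representations
`π`, `π'` of `GL_n(𝔸_K)` (`0 < n`) with Satake families `α`, `γ` off `S`, all `f ∈ π`, `f' ∈ π'`
transforming under the centre by the same scalars of modulus one, every ideal `𝔫₀ ≠ 0` and test
function `η` left invariant under `K(𝔫₀)`, every set of finite places `S' ⊇ S` off which `v ∤ 𝔫₀`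
and `v ∤ 𝔡_{K/ℚ}`, all enumerations `x`, `y` of `α`, `γ` off `S'`, and every real test function
`Φ : 𝔸_Kⁿ → ℝ` that is continuous, `≥ 0`, Schwartz–Bruhat and spherical off `S'` (invariant under
the integral scalings and supported in the integral vectors at every `v ∉ S'`), there is an
**entire** function `F` with

* `F(s) = s (s - 1) · I(s; S̄_η f', S_η f, Φ)` for `re s > 1` (`RankinSelbergIntegralEntire`);
* `F(s) = s (s - 1) · C · partialPairL S' α γ̄ s · ∫_{B({v ∉ S'}) × K} W_φ W̄_{φ'} Φ(e_n ·) |det|^s δ_B⁻¹`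
  for `1 < re s < 2` — unfolding on the strip
  (`exists_rankinSelbergIntegral_star_eq_mul_rankinSelbergTorusPairIntegralC`) and the Euler
  factorisation of §1 for Tate's character, which has conductor `𝒪_v` off `𝔡`
  (`adicComponent_adeleAddChar_unramified`).

The tree's `exists_entire_eq_mul_partialPairL_mul_setIntegral_pair` is the case
`Φ = Φ_∞ ⊗ 𝟙_{𝒪̂ⁿ}` (with the extra residue clause `F(1) = 0` for `π ≠ π'`, dropped here); the
proof is the same. Cogdell (2004), Thm. 2.1–2.2 and §4.2 (proof of Thm. 4.2); Jacquet–Shalika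
(1981), §4, (5.1); with `π' = σ̄` this is the global Rankin–Selberg input of Mœglin–Waldspurger
(1989), Appendice, Cor. (i)(b). -/
theorem stub_global_pair_gen :
    ∀ {n : ℕ} {K : Type} [Field K] [NumberField K]
      [MeasurableSpace (AdeleRing (𝓞 K) K)] [BorelSpace (AdeleRing (𝓞 K) K)] (_hn : 0 < n)
      (μ' : Measure (AdelicGroupData.gl n K).automorphicQuotient)
      [(AdelicGroupData.gl n K).IsAutomorphicMeasure μ']
      (νI : Measure (ideleGroup K)) [νI.IsHaarMeasure]
      (νA : Measure (Fin n → ideleGroup K)) [IsHaarMeasure νA]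
      (νK : Measure ↥(maximalCompactAdelic n K)) [IsHaarMeasure νK]
      (ν₀ : Measure ↥(adelicUnipotent n K)) [IsHaarMeasure ν₀],
      ∃ C : ℝ, 0 < C ∧
      ∀ (P Q : CuspidalAutomorphicRepGL n K μ') (f : P.1.toSubmodule) (f' : Q.1.toSubmodule),
      (∀ z : ideleGroup K, ∃ c : ℂ, ‖c‖ = 1 ∧
      (AdelicGroupData.gl n K).rightRegular μ' (Matrix.GeneralLinearGroup.scalar (Fin n) z)
      (f : (AdelicGroupData.gl n K).L2 μ') = c • (f : (AdelicGroupData.gl n K).L2 μ') ∧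
      (AdelicGroupData.gl n K).rightRegular μ' (Matrix.GeneralLinearGroup.scalar (Fin n) z)
      (f' : (AdelicGroupData.gl n K).L2 μ') = c • (f' : (AdelicGroupData.gl n K).L2 μ')) →
      ∀ {S : Set (HeightOneSpectrum (𝓞 K))} {α γ : SatakeFamily K}, IsSatakeFamilyOf P S α →
      IsSatakeFamilyOf Q S γ →
      ∀ {𝔫₀ : Ideal (𝓞 K)}, 𝔫₀ ≠ 0 →
      ∀ {η : (AdelicGroupData.gl n K).Adelic → ℝ}, IsTestFunctionGL n K η →
      (∀ k : (AdelicGroupData.gl n K).Adelic, k ∈ principalCongruenceLevel n K 𝔫₀ →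
      ∀ g : (AdelicGroupData.gl n K).Adelic, η (k * g) = η g) →
      ∀ {S' : Set (HeightOneSpectrum (𝓞 K))}, S ⊆ S' →
      (∀ v ∉ S', ¬ v.asIdeal ∣ 𝔫₀ ∧ ¬ v.asIdeal ∣ differentIdeal ℤ (𝓞 K)) →
      ∀ {x y : HeightOneSpectrum (𝓞 K) → Fin n → ℂ},
      (∀ v ∉ S', (Finset.univ : Finset (Fin n)).val.map (x v) = α v) →
      (∀ v ∉ S', (Finset.univ : Finset (Fin n)).val.map (y v) = γ v) →
      ∀ {Φ : (Fin n → AdeleRing (𝓞 K) K) → ℝ}, Continuous Φ → (∀ y, 0 ≤ Φ y) →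
      (fun y => ((Φ y : ℝ) : ℂ)) ∈ piSchwartzBruhat K (Fin n) →
      (∀ v ∉ S', IsLastRowSphericalAt n K Φ v) →
      (∀ v ∉ S', ∀ y : Fin n → AdeleRing (𝓞 K) K, Φ y ≠ 0 → ∀ j, Valued.v ((y j).2 v) ≤ 1) →
      ∃ F : ℂ → ℂ, Differentiable ℂ F ∧
      (∀ s : ℂ, 1 < s.re → F s = s * (s - 1) *
      rankinSelbergIntegral μ' νI (fun y => ((Φ y : ℝ) : ℂ)) s
      (star (smoothedForm η (f' : (AdelicGroupData.gl n K).L2 μ')))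
      (smoothedForm η (f : (AdelicGroupData.gl n K).L2 μ'))) ∧
      (∀ s : ℂ, 1 < s.re → s.re < 2 → F s = s * (s - 1) * ((C : ℂ) *
      (partialPairL S' α (fun v => (γ v).map conj) s *
      ∫ p in unitBox {v | v ∉ S'} ×ˢ Set.univ, torusPairIntegrandC n K
      (whittakerCoeff ν₀ (unipotentTateDomain n K) (adeleAddChar K)
      (invQuot (AdelicGroupData.gl n K) (smoothedForm η (f : (AdelicGroupData.gl n K).L2 μ'))))
      (star (whittakerCoeff ν₀ (unipotentTateDomain n K) (adeleAddChar K)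
      (invQuot (AdelicGroupData.gl n K) (smoothedForm η (f' : (AdelicGroupData.gl n K).L2 μ')))))
      Φ s p ∂(νA.prod νK)))) := by
  intro n K _ _ _ _ hn μ' _ νI _ νA _ νK _ ν₀ _
  classical
  haveI : T2Space (GL (Fin n) (AdeleRing (𝓞 K) K)) := t2Space_gl n K
  haveI : LocallyCompactSpace (GL (Fin n) (AdeleRing (𝓞 K) K)) :=
    AdelicGroupData.locallyCompactSpace_generalLinearGroup_adeleRing K (Fin n)
  haveI : SecondCountableTopology (GL (Fin n) (AdeleRing (𝓞 K) K)) :=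
    secondCountableTopology_generalLinearGroup_adeleRing K (Fin n)
  haveI hν₀R : ν₀.IsMulRightInvariant := isMulRightInvariant_of_isHaarMeasure_adelicUnipotent ν₀
  -- `νA` is s-finite (σ-compact group) and `νK` is finite (compact group)
  haveI := locallyCompactSpace_ideleGroup K
  haveI : CompactSpace ↥(maximalCompactAdelic n K) :=
    isCompact_iff_compactSpace.1 (isCompact_maximalCompactAdelic n K)
  obtain ⟨C, hC, hunf⟩ :=
    exists_rankinSelbergIntegral_star_eq_mul_rankinSelbergTorusPairIntegralC (n := n) (K := K) hn μ' νI νA νK ν₀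
  refine ⟨C, hC, fun P Q f f' hZ {S} {α} {γ} hα hγ {𝔫₀} h𝔫₀ {η} hη hηK {S'} hSS' hS' {x} {y} hx hy {Φ} hΦc hΦ0 hΦS
    hΦsph hΦv => ?_⟩
  -- the test function: `g ↦ Φ(e_n g)` is measurable
  have hΦm : Measurable fun g : GL (Fin n) (AdeleRing (𝓞 K) K) => Φ (lastRow n K g) :=
    (hΦc.comp continuous_lastRow).measurable
  -- the entire continuation of `s (s - 1) I(s)`
  obtain ⟨F, hF, hFI, -⟩ := exists_entire_eq_mul_rankinSelbergIntegral_star_of_ne hn μ' νI P Q f f' hη hΦS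
  refine ⟨F, hF, hFI, fun s hs1 hs2 => ?_⟩
  -- Tate's character and fundamental domain
  have hψ : IsGlobalAddChar K (adeleAddChar K) := isGlobalAddChar_adeleAddChar (K := K)
  have h𝓕 : IsFundamentalDomain ↥(rationalUnipotent n K) (unipotentTateDomain n K) ν₀ :=
    isFundamentalDomain_unipotentTateDomain ν₀
  have h𝓕c : IsCompact (closure (unipotentTateDomain n K)) := isCompact_closure_unipotentTateDomain
  have h𝓕m : MeasurableSet (unipotentTateDomain n K) := measurableSet_unipotentTateDomain
  have hGood : ∀ v ∉ S', ¬ v.asIdeal ∣ 𝔫₀ ∧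
      (∀ c ∈ 𝒪[v.adicCompletion K], (adeleAddChar K).adicComponent v c = 1) ∧
      ∀ ϖ : v.adicCompletion K, Valued.v ϖ = WithZero.exp (-1 : ℤ) →
        ∃ c ∈ 𝒪[v.adicCompletion K], (adeleAddChar K).adicComponent v (ϖ⁻¹ * c) ≠ 1 := fun v hv =>
    ⟨(hS' v hv).1, (adicComponent_adeleAddChar_unramified (K := K) (hS' v hv).2).1,
      (adicComponent_adeleAddChar_unramified (K := K) (hS' v hv).2).2⟩
  -- finiteness of the two real unfolded integrals at `re s`
  have hfin : rankinSelbergTorusIntegral n K νA νK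
      (whittakerCoeff ν₀ (unipotentTateDomain n K) (adeleAddChar K)
        (invQuot (AdelicGroupData.gl n K) (smoothedForm η (f : (AdelicGroupData.gl n K).L2 μ')))) Φ s.re ≠ ⊤ :=
    rankinSelbergTorusIntegral_whittakerCoeff_ne_top_of_mem_piSchwartzBruhat hn νA νK ν₀ P f hη hΦS hΦ0 hΦm hs1
  have hfin' : rankinSelbergTorusIntegral n K νA νK
      (whittakerCoeff ν₀ (unipotentTateDomain n K) (adeleAddChar K)
        (invQuot (AdelicGroupData.gl n K) (smoothedForm η (f' : (AdelicGroupData.gl n K).L2 μ')))) Φ s.re ≠ ⊤ :=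
    rankinSelbergTorusIntegral_whittakerCoeff_ne_top_of_mem_piSchwartzBruhat hn νA νK ν₀ Q f' hη hΦS hΦ0 hΦm hs1
  -- unfold on the strip and factor
  rw [hFI s hs1, hunf P Q f f' hZ hη hΦS hΦ0 hΦm hs1 hs2,
    rankinSelbergTorusPairIntegralC_whittakerCoeff_eq_partialPairL_mul_of_spherical hn P Q hα hγ h𝔫₀
      hη.continuous hη.hasCompactSupport hηK f f' h𝓕 h𝓕m h𝓕c hψ hSS' hGood hx hy hΦ0 hΦsph hΦv hΦm νA
      νK hs1 hfin hfin']

end Summit.Langlands.Langlands.Theorems.GlobalPairGen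

end
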